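import Summits.HodgeConjecture.HodgeConjecture.Theorems.F0P3cIwahoriDatumU2Alg       -- ★ PART 1 (algebra, any rank): Weyl element, dominance on `N` ∕ `N̄`, normality, factorisation, `hinj`
import HarnessLib

/-!
# F0 · P3c · road (D) «IWAHORI-U2★» (U2-A), PART 2 (topology + the datum): the Iwahori datum of the Borel of the quasi-split `U(σ, Φ_N)(K)` along a
# dominant diagonal — ANY RANK `N` — as an existence theorem exposing ray ∕ opposite radical ∕ levels, the dominance package at EVERY dominant
# diagonal, and the `N = 2` specialisations [Casselman1995, Prop. 1.4.3, Prop. 1.4.4; BruhatTits1972, (4.4.3)–(4.4.4)]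

Cell `pub/hodgecm-mathlib`, crux H413 = `stmt-HodgeConjecture-24833` (`--supports`, helper lane), route HCCMUnconditional; seat LH6-p05 (g2); road (D) owner
LH6-p04 (g3) DEAL «IWAHORI-U2★» (U2-A) 2026-09-02T06:40:03Z, ruling (G) 06:44:04Z.  THEOREMS ONLY: no `def`, no instance, no notation, no named fact, no sorry.
THE POINT.  ★ `Literature/NumberTheory/Automorphic/UnitaryGroupRankOneIwahoriDatum` (F0P3-p01) builds the Iwahori datum of the Borel of `U(σ,Φ₃)(K)` with the
size pinned to `Fin 3`; its mathematics is rank-free (the rank-free contraction algebra is ★ `UnitaryGroupRayJacquetCriterionAnyRank`).  This file is the SAME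
construction at an arbitrary rank `N` (proofs transported verbatim, `3 ↦ N`), packaged as an EXISTENCE theorem exposing the ray, the opposite radical and the
levels (`exists_iwahoriDatumU`: `𝓘.a = s`, `𝓘.Nbar = w₀Nw₀`, `𝓘.K j = U ∩ K_{γ₀^{j+1}}`), together with the dominance package at EVERY dominant diagonal `s = diag(u)`,
`|u_i∕u_j| ≤ q′ < 1` (`i < j`) — `hbN ∕ hbNbar ∕ hbexh ∕ normality` (`dominant_package`) — so that the H-side `U(Φ₂)(L⁺_v)` of road (D) ((U2-B) LH4-p02: CM transport
`exists_cmIwahoriDatum₂`; (U2-C) LH1-p03: «DOM-GENERAL-H★») is served by `N = 2` (§3).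
* §1 (algebra) is PART 1 = ★ `Theorems/F0P3cIwahoriDatumU2Alg.lean` (same namespace).  DOMINANT means `|u_i∕u_j| ≤ q` for `i < j` (valuations INCREASING down
  the diagonal; at `N = 2`: `|e₀| < |e₁|`, the H-dominant shape of ruling (G)).
* §2 (`K` a non-archimedean local field): `isCompact_level`, `isOpen_level`, `isOpen_intLevel`, `dominant_exhaustion` (hexh), `exists_pow_inv_conj_Nbar_le_level`,
  `exists_level_pow_subset` (neighbourhood basis), **`exists_iwahoriDatumU`**, **`dominant_package`**.
* §3 (`N = 2`): `ratio_le_two`, `exists_units_of_diagonal_two` (the ray `d(α, (σα)⁻¹)`), `exists_units_of_diagonal_lt_two` (a diagonal `diag(e₀,e₁)` with `|e₀| < |e₁|`),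
  `exists_iwahoriDatumU_two`, `dominant_package_two`.
HONEST LABEL: count-neutral; HC_CM is proved only modulo the 7 printed citations (2 remaining: hLiu418 = stmt-HodgeConjecture-24832, h413 = stmt-HodgeConjecture-24833)
until rung 0 closes.

## References
* [Casselman1995] W. Casselman, *Introduction to the theory of admissible representations of `p`-adic reductive groups* (1995 notes), Prop. 1.4.3, Prop. 1.4.4,
  proof of Thm. 5.3.1.
* [BruhatTits1972] F. Bruhat, J. Tits, *Groupes réductifs sur un corps local I*, Publ. Math. IHÉS 41 (1972), (4.4.3)–(4.4.4).
* [BernsteinZelevinsky1976] I. N. Bernstein, A. V. Zelevinsky, Russian Math. Surveys 31:3 (1976), §3.13.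
* [Rogawski1990] J. D. Rogawski, *Automorphic Representations of Unitary Groups in Three Variables* (1990), §1.10 p. 9, §4.4 p. 49.
-/

set_option autoImplicit false
-- the mandated namespace has the single-problem summit's repeated segment (`HodgeConjecture.HodgeConjecture`)
set_option linter.dupNamespace false

noncomputable section

open scoped MatrixGroups Pointwise Topology
open ValuativeRel Matrix
open Literature.NumberTheory.Automorphic Literature.NumberTheory.Automorphic.UnitaryGroup

namespace Summit.HodgeConjecture.HodgeConjecture.Cruxes.H413.F0P3cIwahoriDatumU2

/-! ## §2 Over a non-archimedean local field (any rank): compact open levels, exhaustion, shrinking of `N̄`, the neighbourhood basis, THE DATUM -/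

section Top

variable {K : Type*} [Field K] [ValuativeRel K] [TopologicalSpace K] [IsNonarchimedeanLocalField K]
  (σ : K →+* K) {N : ℕ} {J : Matrix (Fin N) (Fin N) K} (hJ : J = (StdForm.antidiagonal N).over K)

omit hJ in
/-- The level `K_γ ∩ U` is compact (closed embedding `U ↪ GL_N(K)`, ★ `isCompact_congruenceGL`; any rank). [cite: Casselman1995, §1.4, Prop. 1.4.4] -/
theorem isCompact_level (hσc : Continuous σ) (γ : ValueGroupWithZero K) :
    IsCompact (((congruenceGL N γ).comap (unitaryGroupOfForm σ J).subtype : Subgroup ↥(unitaryGroupOfForm σ J)) :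
      Set ↥(unitaryGroupOfForm σ J)) := by
  haveI : T2Space K := (Literature.NumberTheory.GaloisRepresentations.IsNonarchimedeanLocalField.isLocalField K).toT2Space
  have hcl : IsClosed (unitaryGroupOfForm σ J : Set (GL (Fin N) K)) := isClosed_unitaryGroupOfForm hσc J
  exact hcl.isClosedEmbedding_subtypeVal.isCompact_preimage (isCompact_congruenceGL γ)

omit hJ in
/-- The level `K_γ ∩ U` is open (`γ ≠ 0`; ★ `isOpen_congruenceGL`; any rank). [cite: Casselman1995, §1.4, Prop. 1.4.4] -/
theorem isOpen_level {γ : ValueGroupWithZero K} (hγ : γ ≠ 0) :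
    IsOpen (((congruenceGL N γ).comap (unitaryGroupOfForm σ J).subtype : Subgroup ↥(unitaryGroupOfForm σ J)) :
      Set ↥(unitaryGroupOfForm σ J)) :=
  (isOpen_congruenceGL hγ).preimage continuous_subtype_val

omit hJ in
/-- `K₀ = U ∩ GL_N(𝒪)` is open (★ `isOpen_glInt`; compactness is ★ `AnyRank.isCompact_comap_glInt`). [cite: PlatonovRapinchuk1994, §3.3] -/
theorem isOpen_intLevel :
    IsOpen (((glInt N K).comap (unitaryGroupOfForm σ J).subtype : Subgroup ↥(unitaryGroupOfForm σ J)) : Set ↥(unitaryGroupOfForm σ J)) :=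
  (isOpen_glInt N K).preimage continuous_subtype_val

/-- **Exhaustion of `N` by a dominant diagonal, monotone form (`hexh` ∕ `hbexh`, any rank)**: for `s = diag(u)` with ratios `≤ q < 1` (`q ≠ 0`) and any level
`0 ≠ γ < 1`, every `n ∈ N` has `s^{m'} n s^{-m'} ∈ K_γ` for all large `m'` (★ `AnyRank.exists_mem_rayLevel` + dominance of the powers).
[cite: BernsteinZelevinsky1977, §1.9] [cite: Casselman1995, proof of Thm. 5.3.1] -/
theorem dominant_exhaustion {q : ValueGroupWithZero K} (hq0 : q ≠ 0) (hq1 : q < 1) {γ : ValueGroupWithZero K} (hγ0 : γ ≠ 0)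
    (hγ : γ < 1) (s : ↥(unitaryGroupOfForm σ J)) (u : Fin N → Kˣ) (hs : ((s : ↥(unitaryGroupOfForm σ J)) : GL (Fin N) K) = glDiagonal N K u)
    (hu : ∀ i j : Fin N, i < j → valuation K ((u i : K) * ((u j : K))⁻¹) ≤ q) {n : ↥(unitaryGroupOfForm σ J)}
    (hn : n ∈ (borelTriple σ J hJ).N) :
    ∃ m : ℕ, ∀ m' : ℕ, m ≤ m' → s ^ m' * n * (s ^ m')⁻¹ ∈ (congruenceGL N γ).comap (unitaryGroupOfForm σ J).subtype := by
  obtain ⟨i, hi⟩ := AnyRank.exists_mem_rayLevel σ hJ hq0 hq1 hγ0 hγ s u hs hu hn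
  rw [mem_map_conj_zpow_neg_iff] at hi
  refine ⟨i.toNat, fun m' hm' => ?_⟩
  obtain ⟨k, hk⟩ : ∃ k : ℕ, k + i.toNat = m' := ⟨m' - i.toNat, Nat.sub_add_cancel hm'⟩
  by_cases hi0 : 0 ≤ i
  · have hzi : s ^ i = s ^ i.toNat := by
      conv_lhs => rw [← Int.toNat_of_nonneg hi0]
      exact zpow_natCast s i.toNat
    have hmem0 : s ^ i.toNat * n * (s ^ i.toNat)⁻¹ ∈
        (congruenceGL N γ).comap (unitaryGroupOfForm σ J).subtype ⊓ (borelTriple σ J hJ).N := by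
      have : s ^ i * n * s ^ (-i) = s ^ i.toNat * n * (s ^ i.toNat)⁻¹ := by rw [_root_.zpow_neg, hzi]
      rwa [this] at hi
    have hmem := dominant_pow_conj_mem σ hJ hγ hq1.le s u hs hu k hmem0
    have hre : s ^ k * (s ^ i.toNat * n * (s ^ i.toNat)⁻¹) * (s ^ k)⁻¹ = s ^ m' * n * (s ^ m')⁻¹ := by
      rw [← hk, pow_add, _root_.mul_inv_rev]
      simp only [mul_assoc]
    rw [hre] at hmem
    exact (Subgroup.mem_inf.1 hmem).1
  · have hni : 0 ≤ -i := by omega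
    have hzi : s ^ (-i) = s ^ (-i).toNat := by
      conv_lhs => rw [← Int.toNat_of_nonneg hni]
      exact zpow_natCast s (-i).toNat
    have hn' : n ∈ (congruenceGL N γ).comap (unitaryGroupOfForm σ J).subtype ⊓ (borelTriple σ J hJ).N := by
      have hre : n = s ^ (-i).toNat * (s ^ i * n * s ^ (-i)) * (s ^ (-i).toNat)⁻¹ := by
        rw [← hzi, _root_.zpow_neg]
        group
      rw [hre]
      exact dominant_pow_conj_mem σ hJ hγ hq1.le s u hs hu _ hi
    exact (Subgroup.mem_inf.1 (dominant_pow_conj_mem σ hJ hγ hq1.le s u hs hu m' hn')).1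

/-- **`s⁻ⁱ (K_γ ∩ N̄) sⁱ` becomes arbitrarily small** (the `exists_conj_inf_Nbar_le` axiom of ★ `IwahoriDatum`, any rank): for every target level `γ' ≠ 0` some power
has `(sⁱ)⁻¹ • (K_γ ∩ N̄) ≤ K_{γ'}`. [cite: Casselman1995, Prop. 1.4.3] -/
theorem exists_pow_inv_conj_Nbar_le_level {q : ValueGroupWithZero K} (hq0 : q ≠ 0) (hq1 : q < 1) {γ γ' : ValueGroupWithZero K} (hγ : γ < 1)
    (hγ'0 : γ' ≠ 0) (s : ↥(unitaryGroupOfForm σ J)) (u : Fin N → Kˣ) (hs : ((s : ↥(unitaryGroupOfForm σ J)) : GL (Fin N) K) = glDiagonal N K u)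
    (hu : ∀ i j : Fin N, i < j → valuation K ((u i : K) * ((u j : K))⁻¹) ≤ q) :
    ∃ i : ℕ, ConjAct.toConjAct (s ^ i)⁻¹ •
        ((congruenceGL N γ).comap (unitaryGroupOfForm σ J).subtype ⊓ ((borelTriple σ J hJ).N).map (MulAut.conj (weylLongU σ hJ)).toMonoidHom) ≤
      (congruenceGL N γ').comap (unitaryGroupOfForm σ J).subtype := by
  obtain ⟨i, hi⟩ := exists_pow_mul_le hq0 hq1 γ hγ'0
  refine ⟨i, ?_⟩
  rintro _ ⟨x, hx, rfl⟩
  have hmem := dominant_pow_inv_conj_mem_Nbar σ hJ hγ hq1.le s u hs hu i hx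
  have h1 := (Subgroup.mem_inf.1 hmem).1
  rw [MulDistribMulAction.toMonoidEnd_apply, MulDistribMulAction.toMonoidHom_apply, ConjAct.smul_def, ConjAct.ofConjAct_toConjAct, inv_inv]
  exact Subgroup.mem_comap.2 (congruenceGL_mono hi (Subgroup.mem_comap.1 h1))

omit hJ in
/-- **The levels `K_{γ₀^{j+1}} ∩ U` form a neighbourhood basis of `1` in `U`** (`0 ≠ γ₀ < 1`, any rank; ★ `exists_congruenceGL_subset` in `GL_N(K)` and the subspace
topology). [cite: Casselman1995, Prop. 1.4.4] -/
theorem exists_level_pow_subset {γ₀ : ValueGroupWithZero K} (hγ₀0 : γ₀ ≠ 0) (hγ₀1 : γ₀ < 1)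
    {O : Set ↥(unitaryGroupOfForm σ J)} (hO : O ∈ 𝓝 (1 : ↥(unitaryGroupOfForm σ J))) :
    ∃ j : ℕ, (((congruenceGL N (γ₀ ^ (j + 1))).comap (unitaryGroupOfForm σ J).subtype : Subgroup ↥(unitaryGroupOfForm σ J)) :
      Set ↥(unitaryGroupOfForm σ J)) ⊆ O := by
  obtain ⟨O', hO', hsub⟩ := (mem_nhds_induced Subtype.val (1 : ↥(unitaryGroupOfForm σ J)) O).1 hO
  rw [Subgroup.coe_one] at hO'
  obtain ⟨δ, hδ⟩ := exists_congruenceGL_subset hO'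
  obtain ⟨j, hj⟩ := exists_pow_mul_le hγ₀0 hγ₀1 γ₀ (Units.ne_zero δ)
  refine ⟨j, fun y hy => hsub ?_⟩
  show ((y : ↥(unitaryGroupOfForm σ J)) : GL (Fin N) K) ∈ O'
  refine hδ (congruenceGL_mono ?_ (Subgroup.mem_comap.1 hy))
  calc γ₀ ^ (j + 1) = γ₀ ^ j * γ₀ := pow_succ γ₀ j
    _ ≤ (δ : ValueGroupWithZero K) := hj

/-- **THE IWAHORI DATUM OF THE BOREL OF `U(σ, Φ_N)(K)` ALONG A DOMINANT DIAGONAL — ANY RANK, AS AN EXISTENCE THEOREM EXPOSING RAY, OPPOSITE RADICAL AND LEVELS**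
(`σ` continuous; levels `K_j = K_{γ₀^{j+1}} ∩ U` with `0 ≠ γ₀ < 1`; `N̄ = w₀ N w₀`; ray `s = diag(u) ∈ U` with `|u_i∕u_j| ≤ q` for `i < j`, `0 ≠ q < 1`).  The input of ★
`StructureTransport.exists_iwahoriDatum_comap` for (U2-B)'s CM transport at `N = 2`; at `N = 3` it is ★ `iwahoriDatumU3` with ★ `iwahoriDatumU3_K ∕ _a ∕ _Nbar`.
[cite: Casselman1995, Prop. 1.4.4] [cite: BernsteinZelevinsky1976, §3.13] [cite: BruhatTits1972, (4.4.3)–(4.4.4)] -/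
theorem exists_iwahoriDatumU (hσc : Continuous σ) {γ₀ : ValueGroupWithZero K} (hγ₀0 : γ₀ ≠ 0) (hγ₀1 : γ₀ < 1)
    {q : ValueGroupWithZero K} (hq0 : q ≠ 0) (hq1 : q < 1) (s : ↥(unitaryGroupOfForm σ J)) (u : Fin N → Kˣ)
    (hs : ((s : ↥(unitaryGroupOfForm σ J)) : GL (Fin N) K) = glDiagonal N K u)
    (hu : ∀ i j : Fin N, i < j → valuation K ((u i : K) * ((u j : K))⁻¹) ≤ q) :
    ∃ 𝓘 : (borelTriple σ J hJ).IwahoriDatum, 𝓘.a = s ∧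
      𝓘.Nbar = ((borelTriple σ J hJ).N).map (MulAut.conj (weylLongU σ hJ)).toMonoidHom ∧
      ∀ j : ℕ, 𝓘.K j = (congruenceGL N (γ₀ ^ (j + 1))).comap (unitaryGroupOfForm σ J).subtype := by
  haveI : IsValuativeTopology K := IsNonarchimedeanLocalField.toIsValuativeTopology
  refine ⟨{ Nbar := ((borelTriple σ J hJ).N).map (MulAut.conj (weylLongU σ hJ)).toMonoidHom
            a := s
            a_mem := by rw [borelTriple_M, mem_torusU_iff]; exact ⟨u, hs.symm⟩
            a_comm := fun m hm => by
              rw [borelTriple_M] at hm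
              have h := torusU_mul_comm σ J ⟨m, hm⟩ ⟨s, by rw [mem_torusU_iff]; exact ⟨u, hs.symm⟩⟩
              exact congrArg Subtype.val h
            K := fun j => (congruenceGL N (γ₀ ^ (j + 1))).comap (unitaryGroupOfForm σ J).subtype
            isOpen_K := fun j => isOpen_level σ (J := J) (pow_ne_zero _ hγ₀0)
            isCompact_K := fun _ => isCompact_level σ (J := J) hσc _
            hasBasis_K := fun O hO => exists_level_pow_subset σ hγ₀0 hγ₀1 hO
            factorization := fun j => coe_level_eq_mul σ hJ (pow_lt_one₀ zero_le hγ₀1 (Nat.succ_ne_zero j))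
            exists_conj_inf_Nbar_le := fun n j =>
              exists_pow_inv_conj_Nbar_le_level σ hJ hq0 hq1 (pow_lt_one₀ zero_le hγ₀1 (Nat.succ_ne_zero n)) (pow_ne_zero _ hγ₀0) s u hs hu },
    rfl, rfl, fun j => rfl⟩

omit hJ in
/-- **THE DOMINANCE PACKAGE AT EVERY DOMINANT DIAGONAL (any rank; the texts that ruling (G)'s 13th conjunct transports)**: for the levels `K_j = K_{γ₀^{j+1}} ∩ U` and ANY
diagonal `s = diag(u) ∈ U` with `|u_i∕u_j| ≤ q′ < 1` for `i < j`: `s (K_j ∩ N) s⁻¹ ⊆ K_j` (`hbN`), `s⁻¹ (K_j ∩ N̄) s ⊆ K_j ∩ N̄` (`hbNbar`), every `n ∈ N` is eventually conjugated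
into `K_j` by the powers of `s` (`hbexh`), and `K_j` is normalised by `K₀ = U ∩ GL_N(𝒪)`. [cite: Casselman1995, Prop. 1.4.3, Prop. 1.4.4] -/
theorem dominant_package (hJ : J = (StdForm.antidiagonal N).over K) {γ₀ : ValueGroupWithZero K} (hγ₀0 : γ₀ ≠ 0) (hγ₀1 : γ₀ < 1)
    {q' : ValueGroupWithZero K} (hq'0 : q' ≠ 0) (hq'1 : q' < 1) (s : ↥(unitaryGroupOfForm σ J)) (u : Fin N → Kˣ)
    (hs : ((s : ↥(unitaryGroupOfForm σ J)) : GL (Fin N) K) = glDiagonal N K u)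
    (hu : ∀ i j : Fin N, i < j → valuation K ((u i : K) * ((u j : K))⁻¹) ≤ q') (j : ℕ) :
    (∀ x ∈ (congruenceGL N (γ₀ ^ (j + 1))).comap (unitaryGroupOfForm σ J).subtype ⊓ (borelTriple σ J hJ).N,
        s * x * s⁻¹ ∈ (congruenceGL N (γ₀ ^ (j + 1))).comap (unitaryGroupOfForm σ J).subtype) ∧
    (∀ x ∈ (congruenceGL N (γ₀ ^ (j + 1))).comap (unitaryGroupOfForm σ J).subtype ⊓
          ((borelTriple σ J hJ).N).map (MulAut.conj (weylLongU σ hJ)).toMonoidHom,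
        s⁻¹ * x * s ∈ (congruenceGL N (γ₀ ^ (j + 1))).comap (unitaryGroupOfForm σ J).subtype ⊓
          ((borelTriple σ J hJ).N).map (MulAut.conj (weylLongU σ hJ)).toMonoidHom) ∧
    (∀ n ∈ (borelTriple σ J hJ).N, ∃ m : ℕ, ∀ m' : ℕ, m ≤ m' →
        s ^ m' * n * (s ^ m')⁻¹ ∈ (congruenceGL N (γ₀ ^ (j + 1))).comap (unitaryGroupOfForm σ J).subtype) ∧
    (∀ k ∈ (glInt N K).comap (unitaryGroupOfForm σ J).subtype, ∀ κ ∈ (congruenceGL N (γ₀ ^ (j + 1))).comap (unitaryGroupOfForm σ J).subtype,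
        k⁻¹ * κ * k ∈ (congruenceGL N (γ₀ ^ (j + 1))).comap (unitaryGroupOfForm σ J).subtype) := by
  have hγ : γ₀ ^ (j + 1) < 1 := pow_lt_one₀ zero_le hγ₀1 (Nat.succ_ne_zero j)
  refine ⟨fun x hx => dominant_conj_mem_level σ hJ hγ hq'1.le s u hs hu hx, fun x hx => ?_,
    fun n hn => dominant_exhaustion σ hJ hq'0 hq'1 (pow_ne_zero _ hγ₀0) hγ s u hs hu hn,
    fun k hk κ hκ => level_normal σ hk hκ⟩
  exact dominant_inv_conj_mem_Nbar σ hJ hγ ((mul_le_mul' hq'1.le le_rfl).trans (one_mul _).le) s u hs hu hx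

end Top

/-! ## §3 `N = 2`: the ray `d(α, (σα)⁻¹)`, a diagonal `diag(e₀, e₁)` with `|e₀| < |e₁|`, the datum and the package -/

section Two

variable {K : Type*} [Field K] [ValuativeRel K] [TopologicalSpace K] [IsNonarchimedeanLocalField K]
  (σ : K →+* K) {J : Matrix (Fin 2) (Fin 2) K} (hJ : J = (StdForm.antidiagonal 2).over K)

omit [TopologicalSpace K] [IsNonarchimedeanLocalField K] σ hJ in
/-- At `N = 2` the ratio condition is the single inequality `|u₀∕u₁| ≤ q`. [cite: Casselman1995, Prop. 1.4.3] -/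
theorem ratio_le_two {q : ValueGroupWithZero K} (u : Fin 2 → Kˣ) (h : valuation K ((u 0 : K) * ((u 1 : K))⁻¹) ≤ q) :
    ∀ i j : Fin 2, i < j → valuation K ((u i : K) * ((u j : K))⁻¹) ≤ q := by
  intro i j hij
  fin_cases i <;> fin_cases j
  all_goals first | exact absurd hij (by decide) | exact h

omit [TopologicalSpace K] [IsNonarchimedeanLocalField K] hJ in
/-- **The ray data of `d(α, (σα)⁻¹)` at `N = 2`** (T1's `exists_units_of_coe_eq_diagonal` at rank 2): for `σ` valuation-preserving and `0 < |α| < 1`, an element `s ∈ U`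
with matrix `diag(α, (σα)⁻¹)` is `glDiagonal` of units with the single ratio `α·σα` of valuation `≤ |α|`. [cite: Casselman1995, Prop. 1.4.3] [cite: Rogawski1990, §1.10 p. 9] -/
theorem exists_units_of_diagonal_two (hσv : ∀ x, valuation K (σ x) = valuation K x) {α : K} (hα0 : α ≠ 0) (hα1 : valuation K α < 1)
    (s : ↥(unitaryGroupOfForm σ J))
    (hs : (((s : ↥(unitaryGroupOfForm σ J)) : GL (Fin 2) K) : Matrix (Fin 2) (Fin 2) K) = Matrix.diagonal ![α, (σ α)⁻¹]) :
    ∃ u : Fin 2 → Kˣ, ((s : ↥(unitaryGroupOfForm σ J)) : GL (Fin 2) K) = glDiagonal 2 K u ∧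
      (∀ i j : Fin 2, i < j → valuation K ((u i : K) * ((u j : K))⁻¹) ≤ valuation K α) ∧
      valuation K α ≠ 0 ∧ valuation K α < 1 := by
  have hσα0 : σ α ≠ 0 := by
    intro h; apply hα0
    have := congrArg (valuation K) h
    rw [hσv, map_zero] at this
    exact (Valuation.zero_iff _).1 this
  refine ⟨![Units.mk0 α hα0, (Units.mk0 (σ α) hσα0)⁻¹], Units.ext ?_, ratio_le_two _ ?_, (Valuation.ne_zero_iff _).2 hα0, hα1⟩
  · rw [hs, coe_glDiagonal]
    congr 1
    funext k
    fin_cases k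
    · rfl
    · rfl
  · simp only [Matrix.cons_val_zero, Matrix.cons_val_one, Matrix.cons_val_fin_one, Units.val_inv_eq_inv_val, Units.val_mk0, inv_inv,
      map_mul, hσv]
    calc valuation K α * valuation K α ≤ valuation K α * 1 := mul_le_mul' le_rfl hα1.le
      _ = valuation K α := mul_one _

omit [TopologicalSpace K] [IsNonarchimedeanLocalField K] hJ in
/-- **A DOMINANT diagonal at `N = 2`**: an element `s ∈ U` with matrix `diag(e₀, e₁)` and `|e₀| < |e₁|` is `glDiagonal` of units whose single ratio has valuation
`q′ := |e₀∕e₁|` with `0 ≠ q′ < 1` (the H-dominant shape of ruling (G); `Valued.v`-form via ★ `v_lt_iff_valuation_lt`). [cite: Casselman1995, Prop. 1.4.3] -/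
theorem exists_units_of_diagonal_lt_two (s : ↥(unitaryGroupOfForm σ J)) {e₀ e₁ : K}
    (hs : (((s : ↥(unitaryGroupOfForm σ J)) : GL (Fin 2) K) : Matrix (Fin 2) (Fin 2) K) = Matrix.diagonal ![e₀, e₁])
    (hlt : valuation K e₀ < valuation K e₁) :
    ∃ (u : Fin 2 → Kˣ) (q' : ValueGroupWithZero K), ((s : ↥(unitaryGroupOfForm σ J)) : GL (Fin 2) K) = glDiagonal 2 K u ∧ q' ≠ 0 ∧ q' < 1 ∧
      ∀ i j : Fin 2, i < j → valuation K ((u i : K) * ((u j : K))⁻¹) ≤ q' := by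
  -- the entries are units (`s` is invertible with diagonal matrix)
  have hdet : IsUnit (((s : ↥(unitaryGroupOfForm σ J)) : GL (Fin 2) K) : Matrix (Fin 2) (Fin 2) K).det :=
    (Matrix.isUnit_iff_isUnit_det _).1 (Units.isUnit _)
  rw [hs, Matrix.det_diagonal, Fin.prod_univ_two] at hdet
  simp only [Matrix.cons_val_zero, Matrix.cons_val_one, Matrix.cons_val_fin_one] at hdet
  have he₀ : e₀ ≠ 0 := left_ne_zero_of_mul hdet.ne_zero
  have he₁ : e₁ ≠ 0 := right_ne_zero_of_mul hdet.ne_zero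
  have hv₁ : valuation K e₁ ≠ 0 := (Valuation.ne_zero_iff _).2 he₁
  refine ⟨![Units.mk0 e₀ he₀, Units.mk0 e₁ he₁], valuation K e₀ * (valuation K e₁)⁻¹, Units.ext ?_, ?_, ?_, ratio_le_two _ ?_⟩
  · rw [hs, coe_glDiagonal]
    congr 1
    funext k
    fin_cases k
    · rfl
    · rfl
  · exact mul_ne_zero ((Valuation.ne_zero_iff _).2 he₀) (inv_ne_zero hv₁)
  · rw [mul_inv_lt_iff₀ (zero_lt_iff.2 hv₁), one_mul]
    exact hlt
  · simp only [Matrix.cons_val_zero, Matrix.cons_val_one, Matrix.cons_val_fin_one, Units.val_mk0, map_mul, map_inv₀]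
    exact le_rfl

/-- **THE `U(σ, Φ₂)(K)` IWAHORI DATUM ALONG THE RAY `d(α, (σα)⁻¹)`** (`0 < |α| < 1`, `σ` continuous and valuation-preserving): levels `K_j = K_{|α|^{j+1}} ∩ U`,
`N̄ = w₀Nw₀`, ray `s`. [cite: Casselman1995, Prop. 1.4.4] [cite: Rogawski1990, §4.4 p. 49] -/
theorem exists_iwahoriDatumU_two (hσc : Continuous σ) (hσv : ∀ x, valuation K (σ x) = valuation K x) {α : K} (hα0 : α ≠ 0)
    (hα1 : valuation K α < 1) (s : ↥(unitaryGroupOfForm σ J))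
    (hs : (((s : ↥(unitaryGroupOfForm σ J)) : GL (Fin 2) K) : Matrix (Fin 2) (Fin 2) K) = Matrix.diagonal ![α, (σ α)⁻¹]) :
    ∃ 𝓘 : (borelTriple σ J hJ).IwahoriDatum, 𝓘.a = s ∧
      𝓘.Nbar = ((borelTriple σ J hJ).N).map (MulAut.conj (weylLongU σ hJ)).toMonoidHom ∧
      ∀ j : ℕ, 𝓘.K j = (congruenceGL 2 ((valuation K α) ^ (j + 1))).comap (unitaryGroupOfForm σ J).subtype := by
  obtain ⟨u, hsu, hu, hq0, hq1⟩ := exists_units_of_diagonal_two σ hσv hα0 hα1 s hs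
  exact exists_iwahoriDatumU σ hJ hσc hq0 hq1 hq0 hq1 s u hsu hu

/-- **THE DOMINANCE PACKAGE AT A DOMINANT DIAGONAL `diag(e₀, e₁)`, `|e₀| < |e₁|`, OF `U(σ, Φ₂)(K)`** at the levels `K_{γ₀^{j+1}} ∩ U`: `hbN ∧ hbNbar ∧ hbexh ∧` normality
by `K₀` — the model side of ruling (G)'s 13th conjunct. [cite: Casselman1995, Prop. 1.4.3, Prop. 1.4.4] -/
theorem dominant_package_two {γ₀ : ValueGroupWithZero K} (hγ₀0 : γ₀ ≠ 0) (hγ₀1 : γ₀ < 1) (s : ↥(unitaryGroupOfForm σ J)) {e₀ e₁ : K}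
    (hs : (((s : ↥(unitaryGroupOfForm σ J)) : GL (Fin 2) K) : Matrix (Fin 2) (Fin 2) K) = Matrix.diagonal ![e₀, e₁])
    (hlt : valuation K e₀ < valuation K e₁) (j : ℕ) :
    (∀ x ∈ (congruenceGL 2 (γ₀ ^ (j + 1))).comap (unitaryGroupOfForm σ J).subtype ⊓ (borelTriple σ J hJ).N,
        s * x * s⁻¹ ∈ (congruenceGL 2 (γ₀ ^ (j + 1))).comap (unitaryGroupOfForm σ J).subtype) ∧
    (∀ x ∈ (congruenceGL 2 (γ₀ ^ (j + 1))).comap (unitaryGroupOfForm σ J).subtype ⊓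
          ((borelTriple σ J hJ).N).map (MulAut.conj (weylLongU σ hJ)).toMonoidHom,
        s⁻¹ * x * s ∈ (congruenceGL 2 (γ₀ ^ (j + 1))).comap (unitaryGroupOfForm σ J).subtype ⊓
          ((borelTriple σ J hJ).N).map (MulAut.conj (weylLongU σ hJ)).toMonoidHom) ∧
    (∀ n ∈ (borelTriple σ J hJ).N, ∃ m : ℕ, ∀ m' : ℕ, m ≤ m' →
        s ^ m' * n * (s ^ m')⁻¹ ∈ (congruenceGL 2 (γ₀ ^ (j + 1))).comap (unitaryGroupOfForm σ J).subtype) ∧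
    (∀ k ∈ (glInt 2 K).comap (unitaryGroupOfForm σ J).subtype, ∀ κ ∈ (congruenceGL 2 (γ₀ ^ (j + 1))).comap (unitaryGroupOfForm σ J).subtype,
        k⁻¹ * κ * k ∈ (congruenceGL 2 (γ₀ ^ (j + 1))).comap (unitaryGroupOfForm σ J).subtype) := by
  obtain ⟨u, q', hsu, hq'0, hq'1, hu⟩ := exists_units_of_diagonal_lt_two σ s hs hlt
  exact dominant_package σ hJ hγ₀0 hγ₀1 hq'0 hq'1 s u hsu hu j

end Two

end Summit.HodgeConjecture.HodgeConjecture.Cruxes.H413.F0P3cIwahoriDatumU2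

end
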